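import Mathlib
import HarnessLib
import Literature.NumberTheory.LFunctions.RHWave0
import Literature.NumberTheory.Sieve.MoebiusShiftedPrimesLiouville
import Summits.Parity.GeneralizedHardyLittlewood.Theorems.LiouvilleMADCosetDecorrelationStubQuasiRHOfProgressionMean

/-!
# `TypeIILiouville` (crux stmt-Parity-13322, route `LiouvilleMAD`), line `Sketch`: Stub D

From `λ` to `μ`: a power saving `|L(x)| ≤ C x^{1−δ}` (`x ≥ x₀`, `0 < δ < 1/2`) for the summatory
Liouville function `L(x) = ∑_{n ≤ x} λ(n)` passes to the Mertens function `M(x) = ∑_{n ≤ x} μ(n)`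
(`stub_D`, consumed by Step E of the line, the Landau–Littlewood dictionary).

Mechanism: `μ(n) = ∑_{d² ∣ n} μ(d) λ(n/d²)`, so `M(X) = ∑_{1 ≤ d ≤ X} μ(d) L(⌊X/d²⌋)` and
`|M(X)| ≤ E X^{1−δ} ∑_d d^{−2(1−δ)}`, the series converging because `2(1−δ) > 1`.  This summed
identity and the resulting bound at natural arguments are already in the tree
(`CosetDecorrelation.FareyLevelMeanCoupling.quasiRH_sum_moebius_eq`,
`CosetDecorrelation.FareyLevelMeanCoupling.quasiRH_mertens_natCast_bound`); here we only convert the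
eventual real-variable hypothesis into a bound at every natural `K` (trivial bound `|L(K)| ≤ K < x₀`
below `x₀`) and return to real `x ≥ 0` through `M(x) = M(⌊x⌋)`, `⌊x⌋^{1−δ} ≤ x^{1−δ}`.
-/

noncomputable section

open Finset ArithmeticFunction Filter Asymptotics
open Literature.NumberTheory.LFunctions

namespace Summit.Parity.GeneralizedHardyLittlewood.Theorems.TypeIILiouville

open Summit.Parity.GeneralizedHardyLittlewood.Theorems.CosetDecorrelation.FareyLevelMeanCoupling
  (quasiRH_mertens_natCast_bound)

/-- The trivial bound `|∑_{0 < k ≤ K} λ(k)| ≤ K`. -/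
private theorem stubD_abs_sum_liouville_le (K : ℕ) :
    |∑ k ∈ Ioc 0 K, (liouville k : ℝ)| ≤ K := by
  calc |∑ k ∈ Ioc 0 K, (liouville k : ℝ)| ≤ ∑ k ∈ Ioc 0 K, |(liouville k : ℝ)| :=
        abs_sum_le_sum_abs _ _
    _ ≤ ∑ _k ∈ Ioc 0 K, (1 : ℝ) := sum_le_sum fun k _ => by
        exact_mod_cast Literature.NumberTheory.Sieve.Lichtman2020.abs_liouville_le_one k
    _ = K := by simp

/-- From the eventual bound `|L(x)| ≤ C x^{1−δ}` (`x ≥ x₀`, `δ ≤ 1`) to a bound at every natural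
argument: `|∑_{0 < k ≤ K} λ(k)| ≤ (max C 0 + max x₀ 1) K^{1−δ}` for all `K : ℕ` (below `x₀` use the
trivial bound `|L(K)| ≤ K < x₀ ≤ max x₀ 1 · K^{1−δ}` for `K ≥ 1`). -/
private theorem stubD_liouvilleSum_nat_bound {δ C x₀ : ℝ} (hδ1 : δ ≤ 1)
    (hC : ∀ x : ℝ, x₀ ≤ x → |(liouvilleSum x : ℝ)| ≤ C * x ^ (1 - δ)) (K : ℕ) :
    |∑ k ∈ Ioc 0 K, (liouville k : ℝ)| ≤ (max C 0 + max x₀ 1) * (K : ℝ) ^ (1 - δ) := by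
  have hLK : (liouvilleSum (K : ℝ) : ℝ) = ∑ k ∈ Ioc 0 K, (liouville k : ℝ) := by
    simp only [liouvilleSum, Nat.floor_natCast, Int.cast_sum]
  have hKθ : 0 ≤ (K : ℝ) ^ (1 - δ) := Real.rpow_nonneg (Nat.cast_nonneg _) _
  have hC' : C ≤ max C 0 + max x₀ 1 := by
    linarith [le_max_left C 0, le_max_right x₀ 1]
  have hx₀' : max x₀ 1 ≤ max C 0 + max x₀ 1 := by
    linarith [le_max_right C 0]
  rcases le_or_gt x₀ (K : ℝ) with hK | hK
  · calc |∑ k ∈ Ioc 0 K, (liouville k : ℝ)| = |(liouvilleSum (K : ℝ) : ℝ)| := by rw [hLK]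
      _ ≤ C * (K : ℝ) ^ (1 - δ) := hC _ hK
      _ ≤ (max C 0 + max x₀ 1) * (K : ℝ) ^ (1 - δ) := mul_le_mul_of_nonneg_right hC' hKθ
  · rcases Nat.eq_zero_or_pos K with rfl | hKpos
    · simp only [Ioc_self, sum_empty, abs_zero]
      positivity
    · have hK1 : (1 : ℝ) ≤ K := by exact_mod_cast hKpos
      have hKθ1 : (1 : ℝ) ≤ (K : ℝ) ^ (1 - δ) := Real.one_le_rpow hK1 (by linarith)
      calc |∑ k ∈ Ioc 0 K, (liouville k : ℝ)| ≤ K := stubD_abs_sum_liouville_le K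
        _ ≤ max x₀ 1 := hK.le.trans (le_max_left _ _)
        _ ≤ max x₀ 1 * (K : ℝ) ^ (1 - δ) :=
            le_mul_of_one_le_right (zero_le_one.trans (le_max_right _ _)) hKθ1
        _ ≤ (max C 0 + max x₀ 1) * (K : ℝ) ^ (1 - δ) := mul_le_mul_of_nonneg_right hx₀' hKθ

/-- **Stub D.** `μ(n) = ∑_{d² ∣ n} μ(d) λ(n/d²)`, so `M(x) = ∑_{d≤√x} μ(d) L(x/d²)` and a power saving
`δ < 1/2` passes from `L` to `M`. -/
theorem stub_D : ∀ δ : ℝ, 0 < δ → δ < 1 / 2 →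
    (∃ C x₀ : ℝ, ∀ x : ℝ, x₀ ≤ x → |(liouvilleSum x : ℝ)| ≤ C * x ^ (1 - δ)) →
      ∃ C x₀ : ℝ, ∀ x : ℝ, x₀ ≤ x → |(mertensFunction x : ℝ)| ≤ C * x ^ (1 - δ) := by
  intro δ _ hδ2 h
  obtain ⟨C, x₀, hC⟩ := h
  have hE0 : 0 ≤ max C 0 + max x₀ 1 := by positivity
  obtain ⟨F, hF0, hF⟩ := quasiRH_mertens_natCast_bound (θ := 1 - δ) (by linarith) hE0
    (stubD_liouvilleSum_nat_bound (by linarith) hC)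
  refine ⟨F, 0, fun x hx => ?_⟩
  have hM : (mertensFunction x : ℝ) = ∑ n ∈ Ioc 0 ⌊x⌋₊, (moebius n : ℝ) := by
    simp only [mertensFunction, Int.cast_sum]
  rw [hM]
  calc |∑ n ∈ Ioc 0 ⌊x⌋₊, (moebius n : ℝ)| ≤ F * (⌊x⌋₊ : ℝ) ^ (1 - δ) := hF _
    _ ≤ F * x ^ (1 - δ) :=
        mul_le_mul_of_nonneg_left
          (Real.rpow_le_rpow (Nat.cast_nonneg _) (Nat.floor_le hx) (by linarith)) hF0

end Summit.Parity.GeneralizedHardyLittlewood.Theorems.TypeIILiouville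

end
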